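import Mathlib
import Summits.ValiantsHypothesis.ValiantsHypothesis.Theses.NewtonUnitEquations
import Literature.Computability.AlgebraicComplexity.NewtonPolygonTauTransfer
import Summits.ValiantsHypothesis.ValiantsHypothesis.Theorems.NewtonUnitEquationsTwoProductsPowerSumCriterion


/-!
# `TwoProducts` (stmt-ValiantsHypothesis-5906): the engine of line `corner-log-linearization` is IMPLIED BY the crux

`logSumNewton_of_twoProducts`: the crux `TwoProducts` implies the line's registered open stub `stub_logSumNewton`
(the log-sum Newton bound) with the SAME constants: a stable south-west log vertex of a local instance `(u, v)` is,
by the power-sum criterion (landed `PowerSum.stub_powerSumCriterion`), a strict minimiser of a positive integer form on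
`supp(∏u − ∏v)`, hence a strictly exposed — so extreme — point of the hull of that support
(`KPTT.mem_extremePoints_convexHull_of_linear`), and the crux applied to `f := u`, `g := v` counts those.  Together with
`Reduction.twoProducts_of_logSumNewton` this certifies that the engine stub is EQUIVALENT to the crux (up to the constants
`(a, b) ↦ (a+2, b+8)` of the reduction): the line relocates the crux to one local, additively decoupled count; it does not
shrink it.  Definition-free (the line's objects are inlined over Mathlib). [folklore]
-/

set_option linter.dupNamespace false -- single-conjunct summit: `ValiantsHypothesis.ValiantsHypothesis`

namespace Summit.ValiantsHypothesis.ValiantsHypothesis.Theorems.TwoProducts.Equivalence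

open scoped BigOperators Classical

noncomputable section

/-- South-west vertices of a local instance are its stable log vertices (power-sum criterion). [folklore] -/
theorem swVert_eq_logVert {n : ℕ} (u v : Fin n → MvPolynomial (Fin 2) ℂ)
    (hu : ∀ i, MvPolynomial.coeff 0 (u i) = 1) (hv : ∀ i, MvPolynomial.coeff 0 (v i) = 1) :
    {e : Fin 2 →₀ ℕ | ∃ w : Fin 2 → ℤ, 0 < w 0 ∧ 0 < w 1 ∧ ((e) ∈ ((∏ i, u i - ∏ i, v i).support) ∧ ∀ e' ∈ ((∏ i, u i - ∏ i, v i).support), e' ≠ (e) → ((w) 0 * ((e) 0 : ℤ) + (w) 1 * ((e) 1 : ℤ)) < ((w) 0 * ((e') 0 : ℤ) + (w) 1 * ((e') 1 : ℤ)))} = {e : Fin 2 →₀ ℕ | ∃ w : Fin 2 → ℤ, 0 < w 0 ∧ 0 < w 1 ∧ ∀ R : ℕ, ((w) 0 * ((e) 0 : ℤ) + (w) 1 * ((e) 1 : ℤ)) < (R : ℤ) → ((e) ∈ ((∑ r ∈ Finset.Icc 1 R, ((-1 : ℂ) ^ (r + 1) / (r : ℂ)) • (∑ i, (u i - 1) ^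 r - ∑ i, (v i - 1) ^ r)).support) ∧ ∀ e' ∈ ((∑ r ∈ Finset.Icc 1 R, ((-1 : ℂ) ^ (r + 1) / (r : ℂ)) • (∑ i, (u i - 1) ^ r - ∑ i, (v i - 1) ^ r)).support), e' ≠ (e) → ((w) 0 * ((e) 0 : ℤ) + (w) 1 * ((e) 1 : ℤ)) < ((w) 0 * ((e') 0 : ℤ) + (w) 1 * ((e') 1 : ℤ)))} := by
  ext e
  have hPS := Summit.ValiantsHypothesis.ValiantsHypothesis.Theorems.TwoProducts.PowerSum.stub_powerSumCriterion
    n u v hu hv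
  constructor
  · rintro ⟨w, hw0, hw1, h⟩
    exact ⟨w, hw0, hw1, fun R hR => (hPS w hw0 hw1 e R hR).1 h⟩
  · rintro ⟨w, hw0, hw1, h⟩
    refine ⟨w, hw0, hw1, ?_⟩
    have hR : w 0 * (e 0 : ℤ) + w 1 * (e 1 : ℤ) < (((w 0 * (e 0 : ℤ) + w 1 * (e 1 : ℤ)).toNat + 1 : ℕ) : ℤ) := by
      have := Int.self_le_toNat (w 0 * (e 0 : ℤ) + w 1 * (e 1 : ℤ))
      push_cast
      omega
    exact (hPS w hw0 hw1 e _ hR).2 (h _ hR)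

/-- The (negated) integer weight as a real linear functional on `ℝ²`. [folklore] -/
theorem exists_linear_of_weight (w : Fin 2 → ℤ) :
    ∃ l : (Fin 2 → ℝ) →ₗ[ℝ] ℝ, ∀ x : Fin 2 → ℝ, l x = -((w 0 : ℝ) * x 0 + (w 1 : ℝ) * x 1) := by
  refine ⟨-(((w 0 : ℝ)) • LinearMap.proj 0 + ((w 1 : ℝ)) • LinearMap.proj 1), fun x => ?_⟩
  simp

/-- A strict minimiser of an integer form on the support is an extreme point of the hull of the embedded support. [folklore] -/
theorem mem_extremePoints_of_strictMin (F : MvPolynomial (Fin 2) ℂ) (w : Fin 2 → ℤ) (e : Fin 2 →₀ ℕ)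
    (he : e ∈ F.support)
    (hmin : ∀ e' ∈ F.support, e' ≠ e → w 0 * (e 0 : ℤ) + w 1 * (e 1 : ℤ) < w 0 * (e' 0 : ℤ) + w 1 * (e' 1 : ℤ)) :
    (fun i : Fin 2 => ((e i : ℕ) : ℝ)) ∈ Set.extremePoints ℝ (convexHull ℝ
      ((fun e : Fin 2 →₀ ℕ => fun i : Fin 2 => ((e i : ℕ) : ℝ)) '' (F.support : Set (Fin 2 →₀ ℕ)))) := by
  obtain ⟨l, hl⟩ := exists_linear_of_weight w
  refine Literature.Computability.AlgebraicComplexity.KPTT.mem_extremePoints_convexHull_of_linear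
    ⟨e, Finset.mem_coe.2 he, rfl⟩ l ?_
  rintro q ⟨e', he', rfl⟩ hne
  have hne' : e' ≠ e := by
    rintro rfl
    exact hne rfl
  have h := hmin e' (Finset.mem_coe.1 he') hne'
  have h' : ((w 0 : ℝ)) * (e 0 : ℕ) + (w 1 : ℝ) * (e 1 : ℕ) < (w 0 : ℝ) * (e' 0 : ℕ) + (w 1 : ℝ) * (e' 1 : ℕ) := by
    exact_mod_cast h
  rw [hl, hl]
  linarith

/-- **The crux implies the engine.**  `TwoProducts` ⇒ the log-sum Newton bound (registered stub `stub_logSumNewton` of the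
line, stated here verbatim), with the same constants `(a, b)`. [folklore] -/
theorem logSumNewton_of_twoProducts :
    Summit.ValiantsHypothesis.ValiantsHypothesis.Theses.NewtonUnitEquations.TwoProducts →
    ∃ a b : ℕ, ∀ (n t : ℕ) (u v : Fin n → MvPolynomial (Fin 2) ℂ), 3 ≤ t →
      (∀ i, (u i).support.card ≤ t) → (∀ i, (v i).support.card ≤ t) →
      (∀ i, MvPolynomial.coeff 0 (u i) = 1) → (∀ i, MvPolynomial.coeff 0 (v i) = 1) →
      ({e : Fin 2 →₀ ℕ | ∃ w : Fin 2 → ℤ, 0 < w 0 ∧ 0 < w 1 ∧ ∀ R : ℕ, ((w) 0 * ((e) 0 : ℤ) + (w) 1 * ((e) 1 : ℤ)) < (R : ℤ) → ((e) ∈ ((∑ r ∈ Finset.Icc 1 R, ((-1 : ℂ) ^ (r + 1) / (r : ℂ)) • (∑ i, (u i - 1) ^ r - ∑ i, (v i - 1) ^ r)).support) ∧ ∀ e' ∈ ((∑ r ∈ Finset.Icc 1 R, ((-1 : ℂ) ^ (r + 1) / (r : ℂ)) • (∑ i, (u i - 1) ^ r - ∑ i, (v i - 1) ^ r)).support), e'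 ≠ (e) → ((w) 0 * ((e) 0 : ℤ) + (w) 1 * ((e) 1 : ℤ)) < ((w) 0 * ((e') 0 : ℤ) + (w) 1 * ((e') 1 : ℤ)))}).ncard ≤ 2 ^ (a * n) * (t + 2) ^ b := by
  rintro ⟨a, b, h⟩
  refine ⟨a, b, fun n t u v _ht hut hvt hu hv => ?_⟩
  rw [← swVert_eq_logVert u v hu hv]
  set F : MvPolynomial (Fin 2) ℂ := ∏ i, u i - ∏ i, v i with hF
  have key := h n t u v hut hvt
  -- the south-west vertices embed into the extreme points
  have hemb : Function.Injective (fun e : Fin 2 →₀ ℕ => fun i : Fin 2 => ((e i : ℕ) : ℝ)) := by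
    intro e e' hee
    ext i
    have := congrFun hee i
    simp only [Nat.cast_inj] at this
    exact this
  have hsub : (fun e : Fin 2 →₀ ℕ => fun i : Fin 2 => ((e i : ℕ) : ℝ)) '' {e : Fin 2 →₀ ℕ | ∃ w : Fin 2 → ℤ, 0 < w 0 ∧ 0 < w 1 ∧ ((e) ∈ ((F).support) ∧ ∀ e' ∈ ((F).support), e' ≠ (e) → ((w) 0 * ((e) 0 : ℤ) + (w) 1 * ((e) 1 : ℤ)) < ((w) 0 * ((e') 0 : ℤ) + (w) 1 * ((e') 1 : ℤ)))} ⊆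
      Set.extremePoints ℝ (convexHull ℝ ((fun e : Fin 2 →₀ ℕ => fun i : Fin 2 => ((e i : ℕ) : ℝ)) ''
        (F.support : Set (Fin 2 →₀ ℕ)))) := by
    rintro _ ⟨e, ⟨w, -, -, he, hmin⟩, rfl⟩
    exact mem_extremePoints_of_strictMin F w e he hmin
  have hfin : (Set.extremePoints ℝ (convexHull ℝ ((fun e : Fin 2 →₀ ℕ => fun i : Fin 2 => ((e i : ℕ) : ℝ)) ''
      (F.support : Set (Fin 2 →₀ ℕ))))).Finite :=
    ((Finset.finite_toSet F.support).image _).subset extremePoints_convexHull_subset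
  calc ({e : Fin 2 →₀ ℕ | ∃ w : Fin 2 → ℤ, 0 < w 0 ∧ 0 < w 1 ∧ ((e) ∈ ((F).support) ∧ ∀ e' ∈ ((F).support), e' ≠ (e) → ((w) 0 * ((e) 0 : ℤ) + (w) 1 * ((e) 1 : ℤ)) < ((w) 0 * ((e') 0 : ℤ) + (w) 1 * ((e') 1 : ℤ)))}).ncard = ((fun e : Fin 2 →₀ ℕ => fun i : Fin 2 => ((e i : ℕ) : ℝ)) '' {e : Fin 2 →₀ ℕ | ∃ w : Fin 2 → ℤ, 0 < w 0 ∧ 0 < w 1 ∧ ((e) ∈ ((F).support) ∧ ∀ e' ∈ ((F).support), e' ≠ (e) → ((w) 0 * ((e) 0 : ℤ) + (w) 1 * ((e) 1 : ℤ)) < ((w) 0 * ((e') 0 : ℤ) + (w) 1 * ((e') 1 : ℤ)))}).ncard :=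
        (Set.ncard_image_of_injective _ hemb).symm
    _ ≤ _ := Set.ncard_le_ncard hsub hfin
    _ ≤ 2 ^ (a * n) * (t + 2) ^ b := key

end

end Summit.ValiantsHypothesis.ValiantsHypothesis.Theorems.TwoProducts.Equivalence
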